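import Literature.AnabelianGeometry.EtaleTheta.Discharge.Sec5ModelCase
import Literature.AlgebraicGeometry.Frobenioids.PsiBaseEquivalence

/-!
# [EtTh] §5 for a MODEL tempered Frobenioid, II: the 1-compatible base functor `Ψ^bs` ([EtTh] Thm. 4.4 (i) ← [FrdI] Thm. 3.4 (v)) from layer L1 (pp. 320, 328 / PDF pp. 94, 102)

Mochizuki, *The étale theta function …*, Publ. RIMS **45** (2009)
[cite: MochizukiEtTh2009, Thm 4.4 (i) p.320 (PDF p.94)]; *The geometry of Frobenioids I*, Kyushu J. Math.
**62** (2008) [cite: MochizukiFrdI2008, Thm. 3.4 (v) p.63].  Seat abc-iut-L2-d4 (sequel to `Sec5ModelCase.lean`);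
PROOF-ONLY.

Every [EtTh] §5 discharge in this directory (`Sec5Thm56`, `Sec5Thm510ii/iii`, `Sec5Thm510OfRootTransport`,
`Sec5ModelCase.thm510_ii_iii_of_model`) takes as DATA "a faithful 1-compatible `Ψ^bs`": a functor `Ψbs : D ⥤ D`
with `Ψ ⋙ Base ≅ Base ⋙ Ψbs` — [EtTh] Thm. 4.4 (i) "`Ψ` induces a 1-compatible equivalence `Ψ^bs : D₁ ⥲ D₂`",
whose printed source is [FrdI] Thm. 3.4 (v) (p.63: "there is a 1-unique `Ψ^Base : D₁ → D₂` with
`Ψ^Base ∘ Base₁ ≅ Base₂ ∘ Ψ` … the horizontal arrows are equivalences").  Layer L1 has now CONSTRUCTED that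
functor for Frobenioids: abc-iut-L1-d4's `PreFrobenioid.psiBase` with its square `psiBaseSquare`
(`PsiBaseTransport.lean`, p412044) and `psiBase_isEquivalence` (`PsiBaseEquivalence.lean`, p412847), from
"`Ψ` carries pre-steps to base-isomorphisms" ([FrdI] Thm. 3.4 (iii) — for the model a theorem of
abc-iut-L1-t13's `FrdI.thm34ii_of_isOfFSMType`, since pre-steps are preserved and are base-isomorphisms) and
"`Ψ` preserves base-equivalent pairs" ([FrdI] Thm. 3.4 (v), first sentence = sub-node L12b of
plan/L1/SUBDAG-FrdI-Thm34.md, abc-iut-L1-d4's `BaseEquivalencePreserved.lean` p413258, in review at the time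
of writing — kept here as the binders `hbe`, `hbe'`).  This file packages it for §5 data over a MODEL tempered
Frobenioid: `exists_compatBase_of_model` — `∃ Ψbs faithful, Ψ ⋙ Base ≅ Base ⋙ Ψbs` — and feeds it to the
end-to-end Theorem 5.10 (ii)(iii) of `Sec5ModelCase.lean` (`thm510_ii_iii_of_model'`: the data `Ψbs, eΨ`
replaced by `hbe, hbe'`).  HONEST FRAMING: kernel-checked implications; nothing asserts that the §5 data exist
for an actual curve; typed ≠ discharged; no side is taken on anything downstream. -/

-- `(PreFrobenioidData.ofFunctor Φ F).base` is `baseFunctor F` only at default transparency (as in L1's file).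
set_option backward.isDefEq.respectTransparency false

namespace Literature.AnabelianGeometry.EtaleTheta

open CategoryTheory Opposite
open Literature.AlgebraicGeometry.Frobenioids

universe w v u

namespace ThetaFrobenioid

variable {D : Type u} [Category.{v} D] {Φ B : Dᵒᵖ ⥤ CommMonCat.{w}} {DivB : B ⟶ monoidGp Φ}
  {𝔉 : ThetaFrobenioid.{w} (ModelFrobenioid Φ B DivB) D}
  (Ψ : ModelFrobenioid Φ B DivB ≌ ModelFrobenioid Φ B DivB)

/-- For the model Frobenioid over a base of FSM-type, a self-equivalence `Ψ` carries pre-steps to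
base-isomorphisms (the hypothesis `hbi` of abc-iut-L1-d4's `psiBase`): [FrdI] Thm. 3.4 (ii) "`Ψ` preserves
pre-steps" (abc-iut-L1-t13's `FrdI.thm34ii_of_isOfFSMType`) and pre-steps are base-isomorphisms ([FrdI] Def. 1.2
(iii)).  [cite: MochizukiFrdI2008, Thm. 3.4 (ii) p.62] -/
theorem isIso_base_map_of_isPreStep_model (h : ModelFrobenioid.Hypotheses Φ B) (hD : IsOfFSMType D)
    ⦃Y X : ModelFrobenioid Φ B DivB⦄ (α : Y ⟶ X)
    (hα : PreFrobenioid.IsPreStep (ModelFrobenioid.toElem Φ B DivB) α) :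
    IsIso (PreFrobenioid.Base (ModelFrobenioid.toElem Φ B DivB) (Ψ.functor.map α)) := by
  have hF := ModelFrobenioid.isFrobenioid (DivB := DivB) h.isMonoidOn h.isDivisorial h.isMonoidOn_rat
    h.isGroupLike_rat h.isGraphConnected h.isTotallyEpimorphic
  have hq := ModelFrobenioid.data_isOfQuasiIsotropicType (DivB := DivB) h
  have hpre := (FrdI.thm34ii_of_isOfFSMType hF hF hq hq hD hD Ψ).1
  exact ((PreFrobenioidData.ofFunctor_isPreStep _ _).mp
    (hpre α ((PreFrobenioidData.ofFunctor_isPreStep _ α).mpr hα))).2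

/-- **[EtTh] Thm. 4.4 (i) / [FrdI] Thm. 3.4 (v) for the model: a faithful 1-compatible `Ψ^bs`.**  For §5 data over
a model tempered Frobenioid over a base of FSM-type, every self-equivalence `Ψ` admits a FAITHFUL functor
`Ψbs : D ⥤ D` (indeed an equivalence — abc-iut-L1-d4's `psiBase`, `psiBase_isEquivalence`) with
`Ψ ⋙ Base ≅ Base ⋙ Ψbs` (`psiBaseSquare`) — the data `(Ψbs, eΨ)` of the §5 discharges — GIVEN that `Ψ` and `Ψ⁻¹`
preserve base-equivalent pairs ([FrdI] Thm. 3.4 (v), first sentence; L1 sub-node L12b, abc-iut-L1-d4's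
`BaseEquivalencePreserved.lean`).  [cite: MochizukiEtTh2009, Thm 4.4 (i) p.320 (PDF p.94)] -/
theorem exists_compatBase_of_model (h𝔉 : 𝔉.pre = PreFrobenioidData.ofModel Φ B DivB)
    (h : ModelFrobenioid.Hypotheses Φ B) (hD : IsOfFSMType D)
    (hbe : ∀ ⦃A X : ModelFrobenioid Φ B DivB⦄ (φ ψ : A ⟶ X), 𝔉.pre.BaseEquivalent φ ψ →
      𝔉.pre.BaseEquivalent (Ψ.functor.map φ) (Ψ.functor.map ψ))
    (hbe' : ∀ ⦃A X : ModelFrobenioid Φ B DivB⦄ (φ ψ : A ⟶ X), 𝔉.pre.BaseEquivalent φ ψ →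
      𝔉.pre.BaseEquivalent (Ψ.inverse.map φ) (Ψ.inverse.map ψ)) :
    ∃ (Ψbs : D ⥤ D) (_ : Ψbs.Faithful), Nonempty (Ψ.functor ⋙ 𝔉.base ≅ 𝔉.base ⋙ Ψbs) := by
  have hF := ModelFrobenioid.isFrobenioid (DivB := DivB) h.isMonoidOn h.isDivisorial h.isMonoidOn_rat
    h.isGroupLike_rat h.isGraphConnected h.isTotallyEpimorphic
  have hb : 𝔉.base = PreFrobenioid.baseFunctor (ModelFrobenioid.toElem Φ B DivB) := by
    change 𝔉.pre.base = _
    rw [h𝔉]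
    rfl
  rw [h𝔉] at hbe hbe'
  have hbeF : ∀ ⦃A X : ModelFrobenioid Φ B DivB⦄ (φ ψ : A ⟶ X),
      PreFrobenioid.BaseEquivalent (ModelFrobenioid.toElem Φ B DivB) φ ψ →
      PreFrobenioid.BaseEquivalent (ModelFrobenioid.toElem Φ B DivB) (Ψ.functor.map φ) (Ψ.functor.map ψ) :=
    hbe
  have hbeF' : ∀ ⦃A X : ModelFrobenioid Φ B DivB⦄ (φ ψ : A ⟶ X),
      PreFrobenioid.BaseEquivalent (ModelFrobenioid.toElem Φ B DivB) φ ψ →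
      PreFrobenioid.BaseEquivalent (ModelFrobenioid.toElem Φ B DivB) (Ψ.inverse.map φ) (Ψ.inverse.map ψ) :=
    hbe'
  have hbi := isIso_base_map_of_isPreStep_model Ψ h hD
  have hbi' : ∀ ⦃Y X : ModelFrobenioid Φ B DivB⦄ (α : Y ⟶ X),
      PreFrobenioid.IsPreStep (ModelFrobenioid.toElem Φ B DivB) α →
      IsIso (PreFrobenioid.Base (ModelFrobenioid.toElem Φ B DivB) (Ψ.inverse.map α)) :=
    isIso_base_map_of_isPreStep_model Ψ.symm h hD
  haveI := PreFrobenioid.psiBase_isEquivalence hF hF Ψ hbi hbeF hbi' hbeF'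
  rw [hb]
  exact ⟨PreFrobenioid.psiBase hF Ψ.functor hbi hbeF, inferInstance,
    ⟨PreFrobenioid.psiBaseSquare hF Ψ.functor hbi hbeF⟩⟩

section EndToEnd

variable (α : Ψ.functor.obj 𝔉.AN ≅ 𝔉.AN) (β : Ψ.functor.obj 𝔉.BN ≅ 𝔉.BN)

/-- **[EtTh] Theorem 5.10 (ii) and (iii), model case, END-TO-END — with the 1-compatible `Ψ^bs` SUPPLIED BY LAYER L1**
(`exists_compatBase_of_model`): `Sec5ModelCase.thm510_ii_iii_of_model` with its data `(Ψbs, eΨ)` replaced by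
"`Ψ`, `Ψ⁻¹` preserve base-equivalent pairs" ([FrdI] Thm. 3.4 (v), first sentence; L1 sub-node L12b).  Remaining
inputs: abc-iut-L2-t4's `Facts`, `Ψ^birat_Aut` with the birational square and `Ψ^birat_Aut(K^×) = K^×` ([FrdI]
Prop. 4.4, [EtTh] Prop. 3.4 (ii)), Prop. 5.3 (vi) read at `A_N`, the printed conclusion of Thm. 5.7 read for the
unit (`hζ`), and the anabelian transport data of Thm. 4.4 (iv) / Prop. 2.4.
[cite: MochizukiEtTh2009, Thm 5.10 (ii)(iii) p.333–335 (PDF pp.107–109); Thm 4.4 (i) p.320 (PDF p.94)] -/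
theorem thm510_ii_iii_of_model' (h𝔉 : 𝔉.pre = PreFrobenioidData.ofModel Φ B DivB)
    (h : ModelFrobenioid.Hypotheses Φ B) (hD : IsOfFSMType D) (H : 𝔉.Facts)
    (ΨbiratAut : 𝔉.biratUnits 𝔉.BN ≃* 𝔉.biratUnits 𝔉.BN)
    (hbe : ∀ ⦃A X : ModelFrobenioid Φ B DivB⦄ (φ ψ : A ⟶ X), 𝔉.pre.BaseEquivalent φ ψ →
      𝔉.pre.BaseEquivalent (Ψ.functor.map φ) (Ψ.functor.map ψ))
    (hbe' : ∀ ⦃A X : ModelFrobenioid Φ B DivB⦄ (φ ψ : A ⟶ X), 𝔉.pre.BaseEquivalent φ ψ →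
      𝔉.pre.BaseEquivalent (Ψ.inverse.map φ) (Ψ.inverse.map ψ))
    (hsq : ∀ u : 𝔉.units 𝔉.BN, ∀ hu : 𝔉.psiAut Ψ β u ∈ 𝔉.units 𝔉.BN,
      ΨbiratAut (𝔉.unitsToBirat 𝔉.BN u) = 𝔉.unitsToBirat 𝔉.BN ⟨_, hu⟩)
    (hconst : 𝔉.constEmb.range.map ΨbiratAut.toMonoidHom = 𝔉.constEmb.range)
    (e : 𝔉.AN ≅ 𝔉.AN)
    (hcap : 𝔉.pre.div (α.inv ≫ Ψ.functor.map 𝔉.sCap ≫ β.hom) = 𝔉.pre.div (e.hom ≫ 𝔉.sCap))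
    (hcup : 𝔉.pre.div (α.inv ≫ Ψ.functor.map 𝔉.sCup ≫ β.hom) = 𝔉.pre.div (e.hom ≫ 𝔉.sCup))
    (hζ : ∀ Dc Dp : Aut 𝔉.BN,
      α.inv ≫ Ψ.functor.map 𝔉.sCap ≫ β.hom = e.hom ≫ 𝔉.sCap ≫ Dc.hom →
      α.inv ≫ Ψ.functor.map 𝔉.sCup ≫ β.hom = e.hom ≫ 𝔉.sCup ≫ Dp.hom →
      ∀ hu : Dc⁻¹ * Dp ∈ 𝔉.units 𝔉.BN, ∃ ζ : 𝔉.Kˣ, ζ ^ (2 * 𝔉.l) = 1 ∧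
        𝔉.unitsToBirat 𝔉.BN ⟨Dc⁻¹ * Dp, hu⟩ ^ (𝔉.N : ℕ) = 𝔉.constEmb ζ)
    (θ : Aut (𝔉.base.obj 𝔉.BN) ≃* Aut (𝔉.base.obj 𝔉.BN))
    (hstrv : ∀ g : Aut (𝔉.base.obj 𝔉.BN),
      α.inv ≫ Ψ.functor.map (𝔉.strv (𝔉.autBaseIsoAB.symm g)).hom ≫ α.hom ≫ e.hom =
        e.hom ≫ (𝔉.strv (𝔉.autBaseIsoAB.symm (θ g))).hom)
    (hY : 𝔉.imPiY.map θ.toMonoidHom = 𝔉.imPiY) (hYdd : 𝔉.HB.map θ.toMonoidHom = 𝔉.HB)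
    (ψY : 𝔉.PiX ≃ₜ* 𝔉.PiX)
    (hbase : ∀ g, 𝔉.autBase 𝔉.BN (𝔉.psiAut Ψ β (𝔉.sgpCap (𝔉.ρ g))) = 𝔉.ρ (ψY g))
    (hψY : 𝔉.PiY.map ψY.toMulEquiv.toMonoidHom = 𝔉.PiY)
    (hψYdd : 𝔉.PiYdd.map ψY.toMulEquiv.toMonoidHom = 𝔉.PiYdd) :
    𝔉.PsiAutPreserves Ψ β ΨbiratAut ∧
      𝔉.MonoThetaEnvCompat H.sectionsFactor 𝔉.outerActionLZ_of H.sgpCapSection H.sgpCupSection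
        H.constantsEqNormalizer ∅ Ψ β ψY hbase hψY hψYdd := by
  obtain ⟨Ψbs, hΨbs, ⟨eΨ⟩⟩ := exists_compatBase_of_model Ψ h𝔉 h hD hbe hbe'
  haveI := hΨbs
  exact thm510_ii_iii_of_model Ψ α β h𝔉 h hD H ΨbiratAut Ψbs eΨ hsq hconst e hcap hcup hζ θ hstrv hY hYdd
    ψY hbase hψY hψYdd

/-- **[EtTh] Theorem 5.6, model case — with `Ψ^bs` supplied by layer L1.**  `Sec5ModelCase.cyclotomicRigidityPreserved_of_model`
with `(Ψbs, eΨ)` replaced by base-equivalence preservation for `Ψ`, `Ψ⁻¹` ([FrdI] Thm. 3.4 (v) first sentence).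
The transport `aΨ` of `(l·Δ_Θ) ⊗ ℤ/Nℤ` and the other inputs are as there.
[cite: MochizukiEtTh2009, Thm 5.6 p.328–329 (PDF pp.102–103); Thm 4.4 (i) p.320 (PDF p.94)] -/
theorem cyclotomicRigidityPreserved_of_model' (h𝔉 : 𝔉.pre = PreFrobenioidData.ofModel Φ B DivB)
    (h : ModelFrobenioid.Hypotheses Φ B) (hD : IsOfFSMType D) (hnd : IsNonDilatingOn Φ)
    (hN : ∃ A : ModelFrobenioid Φ B DivB, ¬ (PreFrobenioidData.ofModel Φ B DivB).IsGroupLikeObj A)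
    (hbe : ∀ ⦃A X : ModelFrobenioid Φ B DivB⦄ (φ ψ : A ⟶ X), 𝔉.pre.BaseEquivalent φ ψ →
      𝔉.pre.BaseEquivalent (Ψ.functor.map φ) (Ψ.functor.map ψ))
    (hbe' : ∀ ⦃A X : ModelFrobenioid Φ B DivB⦄ (φ ψ : A ⟶ X), 𝔉.pre.BaseEquivalent φ ψ →
      𝔉.pre.BaseEquivalent (Ψ.inverse.map φ) (Ψ.inverse.map ψ))
    (aΨ : ∀ S : ModelFrobenioid Φ B DivB, 𝔉.lDeltaModN S ≃* 𝔉.lDeltaModN (Ψ.functor.obj S))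
    (ρ : FrobenioidCyclotomicRigidity.RigidityFamily 𝔉) (hB : 𝔉.IsThetaSaturated 𝔉.BN)
    (hreach : FrobenioidCyclotomicRigidity.LinearlyReachableFromBN 𝔉)
    (hρ : FrobenioidCyclotomicRigidity.IsFunctorialLinear 𝔉 ρ)
    (haΨ : ∀ {S T : ModelFrobenioid Φ B DivB} (φ : S ⟶ T) (x : 𝔉.lDeltaModN S),
      aΨ T (𝔉.lDeltaModNMap φ x) = 𝔉.lDeltaModNMap (Ψ.functor.map φ) (aΨ S x))
    (hpull : ∀ {S T : ModelFrobenioid Φ B DivB} (φ : S ⟶ T) (u : 𝔉.muTorsion T 𝔉.N)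
      (hu : Ψ.functor.mapAut T (u : Aut T) ∈ 𝔉.muTorsion (Ψ.functor.obj T) 𝔉.N),
      Ψ.functor.mapAut S (𝔉.muTorsionPull φ 𝔉.N u : Aut S) =
        (𝔉.muTorsionPull (Ψ.functor.map φ) 𝔉.N ⟨_, hu⟩ : Aut (Ψ.functor.obj S)))
    (hBN : ∀ (hΨB : 𝔉.IsThetaSaturated (Ψ.functor.obj 𝔉.BN)) (x : 𝔉.lDeltaModN 𝔉.BN),
      (Ψ.functor.mapAut 𝔉.BN (ρ 𝔉.BN hB x : Aut 𝔉.BN) : Aut (Ψ.functor.obj 𝔉.BN)) =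
        ρ (Ψ.functor.obj 𝔉.BN) hΨB (aΨ 𝔉.BN x)) :
    FrobenioidCyclotomicRigidity.CyclotomicRigidityPreserved 𝔉 Ψ ρ aΨ := by
  obtain ⟨Ψbs, hΨbs, ⟨eΨ⟩⟩ := exists_compatBase_of_model Ψ h𝔉 h hD hbe hbe'
  haveI := hΨbs
  exact cyclotomicRigidityPreserved_of_model Ψ h𝔉 h hD hnd hN Ψbs eΨ aΨ ρ hB hreach hρ haΨ hpull hBN

end EndToEnd

end ThetaFrobenioid

end Literature.AnabelianGeometry.EtaleTheta
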